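import Literature.Topology.FourManifolds.SaddleLevelDisconnected
import Literature.Topology.FourManifolds.DisconnectedLevelNotSimplyConnected
import Literature.Topology.FourManifolds.SPC4HandleChainProofs
import Literature.Topology.FourManifolds.MorseTurnAbout
import Literature.Topology.FourManifolds.MorseExtrema
import HarnessLib

/-!
# A Morse function with one minimum and one maximum on an oriented simply connected closed
# surface has no saddle

Topic `Literature/Topology/FourManifolds` (the dimension-`2` leaf of
`Literature.Topology.FourManifolds.HomotopySphere.contractibleSpace_compl_image_ball`, assembled
in `HomotopySpheresSumDimTwo.lean`).  Everything here is **proved**.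

**Theorem** (`criticalSetOfIndex_one_eq_empty`).  Let `M` be a closed connected smooth surface
carrying a smooth orientation and simply connected, and `f` a Morse function on `M` with exactly
one critical point of index `0` and one of index `2`.  Then `f` has no critical point of index
`1`.

This is the Morse-theoretic content of "a closed simply connected surface is a sphere"
(Matsumoto, *An Introduction to Morse Theory* (2001), §1.5(b) with Thm. 3.35: `χ = 2 - (number of
saddles)` for a `1`-min-`1`-max Morse function on an orientable surface; Hirsch, *Differential
Topology* (1976), Ch. 9 §3), obtained without handle decompositions or Euler characteristics:

1. make the critical values distinct (Milnor 1965, Lemma 2.8; tree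
   `IsMorseAdapted.exists_injOn_criticalSet`), choose a gradient-like field (Milnor Lemma 3.2;
   `IsMorse.exists_isGradientLike`), and consider the lowest saddle `s` (if any) — alone on its
   level, with only the minimum below it: a `LowestSaddle` configuration
   (`SaddleLevelCircle.lean`);
2. the orientation makes the level just above `s` disconnected
   (`LowestSaddle.exists_level_split`, `SaddleLevelDisconnected.lean`);
3. a disconnected regular level of a `1`-min-`1`-max Morse function contradicts simple
   connectivity (`IsGradientLike.not_simplyConnectedSpace_of_level_split`,
   `DisconnectedLevelNotSimplyConnected.lean`).

## References

* Y. Matsumoto, *An Introduction to Morse Theory*, AMS (2001), §1.5(b) (pp. 26–29), Thm. 3.35.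
  [Matsumoto2001]
* M. W. Hirsch, *Differential Topology*, GTM 33 (1976), Ch. 9 §3. [HirschDT1976]
* J. Milnor, *Lectures on the h-cobordism theorem*, Princeton (1965), Lemma 2.8, Lemma 3.2.
  [MilnorHCobordism1965]
-/

open scoped Manifold ContDiff Topology
open Set Function Filter Module

noncomputable section

namespace Literature.Topology.FourManifolds

open Flow MilnorBox

variable {M : Type*} [TopologicalSpace M] [ChartedSpace (EuclideanSpace ℝ (Fin 2)) M] [IsManifold (𝓡 2) ∞ M]
  [T2Space M] [CompactSpace M]

omit [IsManifold (𝓡 2) ∞ M] [T2Space M] [CompactSpace M] in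
/-- Shifting a Morse function by a constant keeps it Morse, with the same critical set and the
same indices. [folklore] -/
theorem isMorse_sub_const_and {f : M → ℝ} (hf : IsMorse (𝓡 2) f) (C : ℝ) :
    IsMorse (𝓡 2) (fun y => f y - C) ∧ criticalSet (𝓡 2) (fun y => f y - C) = criticalSet (𝓡 2) f ∧
      ∀ x, morseIndex (𝓡 2) (fun y => f y - C) x = morseIndex (𝓡 2) f x := by
  have hfun : (fun y => f y - C) = fun y => 0 - (C - f y) := by funext y; ring
  have hev : ∀ x : M, (fun y => f y - C) =ᶠ[𝓝 x] fun y => f y + (-C) :=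
    fun x => Eventually.of_forall fun y => by ring
  refine ⟨by rw [hfun]; exact (hf.const_sub C).const_sub 0, ?_, fun x => ?_⟩
  · ext x
    exact isMCriticalPt_congr_of_eventuallyEq_add_const (hev x)
  · unfold morseIndex
    rw [mhessian_congr_of_eventuallyEq_add_const (hev x)]

/-- **The main theorem of the file.**  On a closed connected smooth surface with a smooth
orientation, simply connected, a Morse function with exactly one critical point of index `0`
and one of index `2` has no critical point of index `1`. [cite: Matsumoto2001, §1.5(b) (pp. 26–29) and Thm. 3.35] [cite: HirschDT1976, Ch. 9 §3] -/
theorem criticalSetOfIndex_one_eq_empty [ConnectedSpace M] [SimplyConnectedSpace M]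
    (o : SmoothOrientation (𝓡 2) M) {f : M → ℝ} (hfM : IsMorse (𝓡 2) f) {pbot ptop : M}
    (hbot : criticalSetOfIndex (𝓡 2) f 0 = {pbot}) (htop : criticalSetOfIndex (𝓡 2) f 2 = {ptop}) :
    criticalSetOfIndex (𝓡 2) f 1 = ∅ := by
  classical
  by_contra hne
  obtain ⟨s₀, hs₀⟩ := Set.nonempty_iff_ne_empty.2 hne
  -- Step 1: shift below `1` and separate the critical values
  obtain ⟨x₁, -, hx₁⟩ := isCompact_univ.exists_isMaxOn univ_nonempty hfM.contMDiff.continuous.continuousOn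
  set C := f x₁ + 1 with hC
  set f₀ : M → ℝ := fun y => f y - C with hf₀
  obtain ⟨hf₀M, hcrit₀, hidx₀⟩ := isMorse_sub_const_and hfM C
  have hlt₀ : ∀ y, f₀ y < 1 := fun y => by
    have h1 : f y ≤ f x₁ := hx₁ (mem_univ y)
    show f y - (f x₁ + 1) < 1
    linarith
  have hadapt : IsMorseAdapted (𝓡 2) f₀ := by
    refine ⟨hf₀M, fun x hx => ?_, fun x _ => hlt₀ x⟩
    rw [ModelWithCorners.Boundaryless.boundary_eq_empty] at hx
    exact hx.elim
  obtain ⟨g, hg, hcritg, hidxg, hinj⟩ :=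
    hadapt.exists_injOn_criticalSet (IsMorse.finite_criticalSet_holds hf₀M)
  have hgM : IsMorse (𝓡 2) g := hg.1
  -- critical sets and indices of `g` agree with those of `f`
  have hcritgf : criticalSet (𝓡 2) g = criticalSet (𝓡 2) f := hcritg.trans hcrit₀
  have hidxgf : ∀ q ∈ criticalSet (𝓡 2) f, morseIndex (𝓡 2) g q = morseIndex (𝓡 2) f q :=
    fun q hq => (hidxg q (hcrit₀.symm ▸ hq)).trans (hidx₀ q)
  have hCOI : ∀ k, criticalSetOfIndex (𝓡 2) g k = criticalSetOfIndex (𝓡 2) f k := fun k => by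
    ext q
    simp only [mem_criticalSetOfIndex]
    constructor
    · rintro ⟨hq, hk⟩
      have hq' : q ∈ criticalSet (𝓡 2) f := hcritgf ▸ (hq : q ∈ criticalSet (𝓡 2) g)
      exact ⟨hq', (hidxgf q hq') ▸ hk⟩
    · rintro ⟨hq, hk⟩
      have hq' : q ∈ criticalSet (𝓡 2) g := hcritgf.symm ▸ (hq : q ∈ criticalSet (𝓡 2) f)
      exact ⟨hq', (hidxgf q hq).symm ▸ hk⟩
  have hbotg : criticalSetOfIndex (𝓡 2) g 0 = {pbot} := (hCOI 0).trans hbot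
  have htopg : criticalSetOfIndex (𝓡 2) g 2 = {ptop} := (hCOI 2).trans htop
  have hsadg : s₀ ∈ criticalSetOfIndex (𝓡 2) g 1 := (hCOI 1).symm ▸ hs₀
  -- Step 2: gradient-like field
  obtain ⟨ξ, hgl⟩ := hgM.exists_isGradientLike fun p _ => BoundarylessManifold.isInteriorPoint
  have hξ : ContMDiff (𝓡 2) (𝓡 2).tangent ∞ fun x => (⟨x, ξ x⟩ : TangentBundle (𝓡 2) M) := ξ.contMDiff
  -- Step 3: the lowest saddle
  have hfinT : (criticalSetOfIndex (𝓡 2) g 1).Finite :=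
    (IsMorse.finite_criticalSet_holds hgM).subset (criticalSetOfIndex_subset (𝓡 2) g 1)
  obtain ⟨s, hsT, hsmin⟩ := hfinT.toFinset.exists_min_image g ⟨s₀, hfinT.mem_toFinset.2 hsadg⟩
  rw [hfinT.mem_toFinset] at hsT
  have hsmin' : ∀ s' ∈ criticalSetOfIndex (𝓡 2) g 1, g s ≤ g s' := fun s' hs' =>
    hsmin s' (hfinT.mem_toFinset.2 hs')
  have hs_crit : IsMCriticalPt (𝓡 2) g s := ((mem_criticalSetOfIndex).1 hsT).1
  have hs_idx : morseIndex (𝓡 2) g s = 1 := ((mem_criticalSetOfIndex).1 hsT).2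
  -- the minimum: global minimum point, index `0`, hence `pbot`
  have hpbot_mem : pbot ∈ criticalSetOfIndex (𝓡 2) g 0 := by rw [hbotg]; exact mem_singleton _
  have hpbot_crit : IsMCriticalPt (𝓡 2) g pbot := ((mem_criticalSetOfIndex).1 hpbot_mem).1
  have hpbot_idx : morseIndex (𝓡 2) g pbot = 0 := ((mem_criticalSetOfIndex).1 hpbot_mem).2
  obtain ⟨x₀, -, hx₀⟩ := isCompact_univ.exists_isMinOn univ_nonempty hgM.contMDiff.continuous.continuousOn
  have hx₀loc : IsLocalMin g x₀ := hx₀.isLocalMin univ_mem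
  have hx₀crit : IsMCriticalPt (𝓡 2) g x₀ := IsLocalMin.isMCriticalPt hx₀loc
  have hx₀idx : morseIndex (𝓡 2) g x₀ = 0 := hgM.morseIndex_eq_zero_of_isLocalMin hx₀loc
  have hx₀bot : x₀ = pbot := by
    have : x₀ ∈ criticalSetOfIndex (𝓡 2) g 0 := (mem_criticalSetOfIndex).2 ⟨hx₀crit, hx₀idx⟩
    rw [hbotg] at this; exact this
  have hmin_le : ∀ y, g pbot ≤ g y := fun y => by rw [← hx₀bot]; exact hx₀ (mem_univ y)
  -- values
  have hps : pbot ≠ s := fun h => by rw [h, hs_idx] at hpbot_idx; exact one_ne_zero hpbot_idx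
  have hm_lt_c : g pbot < g s := lt_of_le_of_ne (hmin_le s) fun h => hps (hinj hpbot_crit hs_crit h)
  -- all other critical points lie strictly above `g s`
  have habove : ∀ q, IsMCriticalPt (𝓡 2) g q → q ≠ pbot → q ≠ s → g s < g q := by
    intro q hq hqb hqs
    have hle := morseIndex_le_finrank (𝓡 2) g q
    rw [finrank_euclideanSpace_fin] at hle
    have hge : g s ≤ g q := by
      rcases Nat.lt_or_ge (morseIndex (𝓡 2) g q) 1 with h0 | h1
      · have : q ∈ criticalSetOfIndex (𝓡 2) g 0 := (mem_criticalSetOfIndex).2 ⟨hq, by omega⟩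
        rw [hbotg] at this; exact absurd this hqb
      rcases h1.eq_or_lt with h1 | h2
      · exact hsmin' q ((mem_criticalSetOfIndex).2 ⟨hq, h1.symm⟩)
      · have h2' : morseIndex (𝓡 2) g q = 2 := by omega
        have hqt : q ∈ criticalSetOfIndex (𝓡 2) g 2 := (mem_criticalSetOfIndex).2 ⟨hq, h2'⟩
        rw [htopg] at hqt
        -- `ptop` is the global maximum
        obtain ⟨y₀, -, hy₀⟩ := isCompact_univ.exists_isMaxOn univ_nonempty hgM.contMDiff.continuous.continuousOn
        have hy₀loc : IsLocalMax g y₀ := hy₀.isLocalMax univ_mem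
        have hy₀crit : IsMCriticalPt (𝓡 2) g y₀ := IsLocalMax.isMCriticalPt hy₀loc
        have hy₀idx : morseIndex (𝓡 2) g y₀ = 2 := by
          have := hgM.morseIndex_eq_finrank_of_isLocalMax hy₀loc
          simpa [finrank_euclideanSpace_fin] using this
        have hy₀top : y₀ = ptop := by
          have : y₀ ∈ criticalSetOfIndex (𝓡 2) g 2 := (mem_criticalSetOfIndex).2 ⟨hy₀crit, hy₀idx⟩
          rw [htopg] at this; exact this
        rw [show q = ptop from hqt, ← hy₀top]
        exact hy₀ (mem_univ s)
    exact lt_of_le_of_ne hge fun h => hqs (hinj hq hs_crit h.symm)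
  -- the gap
  set R : Set M := criticalSet (𝓡 2) g \ {pbot, s} with hR
  have hRfin : R.Finite := (IsMorse.finite_criticalSet_holds hgM).subset Set.sdiff_subset
  obtain ⟨η, hη, hηR⟩ : ∃ η : ℝ, 0 < η ∧ ∀ q ∈ R, g s + η ≤ g q := by
    by_cases hRne : R.Nonempty
    · obtain ⟨q₀, hq₀, hq₀min⟩ := hRfin.toFinset.exists_min_image g
        ((Set.Finite.toFinset_nonempty hRfin).2 hRne)
      rw [hRfin.mem_toFinset] at hq₀
      refine ⟨g q₀ - g s, sub_pos.2 (habove q₀ hq₀.1 (fun h => hq₀.2 (Or.inl h))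
        (fun h => hq₀.2 (Or.inr h))), fun q hq => ?_⟩
      have := hq₀min q (hRfin.mem_toFinset.2 hq); linarith
    · exact ⟨1, one_pos, fun q hq => absurd ⟨q, hq⟩ hRne⟩
  -- Step 4: Milnor boxes and parameters
  obtain ⟨Dmin⟩ := hgl.nonempty_milnorBox hpbot_crit
  obtain ⟨Dsad⟩ := hgl.nonempty_milnorBox hs_crit
  have hkmin : Dmin.k = 0 := by
    have h := Dmin.min_k_eq_morseIndex hgM
    rw [hpbot_idx] at h
    rcases Nat.lt_or_ge Dmin.k 2 with h' | h'
    · rw [min_eq_right h'.le] at h; exact h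
    · rw [min_eq_left h'] at h; exact absurd h (by norm_num)
  have hksad : Dsad.k = 1 := by
    have h := Dsad.min_k_eq_morseIndex hgM
    rw [hs_idx] at h
    rcases Nat.lt_or_ge Dsad.k 2 with h' | h'
    · rw [min_eq_right h'.le] at h; exact h
    · rw [min_eq_left h'] at h; exact absurd h (by norm_num)
  set gap := g s - g pbot with hgap
  have hgap_pos : 0 < gap := sub_pos.2 hm_lt_c
  set κ := min (min η (Dsad.ε ^ 2)) gap / 4 with hκ
  have hεs := Dsad.eps_pos
  have hεm := Dmin.eps_pos
  have hminpos : 0 < min (min η (Dsad.ε ^ 2)) gap := lt_min (lt_min hη (by positivity)) hgap_pos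
  have hκ_pos : 0 < κ := by positivity
  have hκ_le_η : κ ≤ η / 4 := by
    have := min_le_left (min η (Dsad.ε ^ 2)) gap; have := min_le_left η (Dsad.ε ^ 2)
    simp only [hκ]; linarith
  have hκ_le_ε : κ ≤ Dsad.ε ^ 2 / 4 := by
    have := min_le_left (min η (Dsad.ε ^ 2)) gap; have := min_le_right η (Dsad.ε ^ 2)
    simp only [hκ]; linarith
  have hκ_le_gap : κ ≤ gap / 4 := by
    have := min_le_right (min η (Dsad.ε ^ 2)) gap; simp only [hκ]; linarith
  set ρ2 := min (Dmin.ε ^ 2) (gap / 4) with hρ2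
  have hρ2_pos : 0 < ρ2 := lt_min (by positivity) (by positivity)
  set ρ := Real.sqrt ρ2 with hρ
  have hρ_sq : ρ ^ 2 = ρ2 := Real.sq_sqrt hρ2_pos.le
  -- the configuration
  let S : LowestSaddle g ξ :=
    { pmin := pbot, sad := s, Dmin := Dmin, Dsad := Dsad, isMorse := hgM, isGradientLike := hgl,
      contMDiff := hξ, kmin := hkmin, ksad := hksad, η := η, κ := κ, δ := κ, ρ := ρ,
      η_pos := hη, κ_pos := hκ_pos, δ_pos := hκ_pos, ρ_pos := Real.sqrt_pos.2 hρ2_pos,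
      κ_lt_η := by linarith, δ_lt_η := by linarith,
      κ_lt := by nlinarith, δ_lt := by nlinarith,
      ρ_lt := by rw [hρ_sq]; have := min_le_left (Dmin.ε ^ 2) (gap / 4); nlinarith,
      base_lt := by
        rw [hρ_sq]; have := min_le_right (Dmin.ε ^ 2) (gap / 4)
        simp only [hgap] at this hκ_le_gap ⊢; linarith,
      crit_ge := fun q hq hqb hqs => hηR q ⟨hq, fun h => by
        rcases h with h | h
        · exact hqb h
        · exact hqs h⟩ }
  -- Step 5: split the level above the saddle and contradict simple connectivity
  obtain ⟨K, K', hKc, hK'c, hdisj, hunion, hKne, hK'ne⟩ := S.exists_level_split o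
  exact (hgl.not_simplyConnectedSpace_of_level_split hgM hξ hbotg htopg S.ε₁_pos
    (fun q hq => S.not_mem_Icc_hi hq) hKc hK'c hdisj hunion hKne hK'ne) ‹SimplyConnectedSpace M›

end Literature.Topology.FourManifolds
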